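import Mathlib.Analysis.SpecialFunctions.Trigonometric.Basic
import Mathlib.Analysis.SpecialFunctions.Complex.Log

/-!
# The stub `stub_normSq_threeTerm` of the line `Sketch` (crux `SpinMonotone`)

Crux `stmt-CriticalPhenomena-16769`
(`Summit.CriticalPhenomena.SAWScalingLimit.Theses.SAWSpinMonotone.SpinMonotone`), line `Sketch`
(adjacent-port reduction, checked skeleton `Cruxes/SpinMonotone/Lines/Sketch.lean`), registered stub
`stub_normSq_threeTerm` (S1, pure algebra).

**Statement.** For real masses `m₀ m₁ m₂`, a sign `ε = ±1` and a real spin `s`,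
`‖m₀ e^{-isεπ/3} + m₁ e^{-isεπ} + m₂ e^{-is·5επ/3}‖² =
  m₀² + m₁² + m₂² + 2(m₀m₁ + m₁m₂) cos(2πs/3) + 2 m₀m₂ cos(4πs/3)`.

**Proof.** With `b = -sεπ/3` the three phases are `e^{ib}`, `e^{3ib}`, `e^{5ib}`; writing
`e^{ikb} = cos kb + i sin kb` the squared modulus is `(Σ mₖ cos θₖ)² + (Σ mₖ sin θₖ)²`, which expands to
`Σ mₖ² + 2 Σ_{j<k} m_j m_k cos(θ_k − θ_j)` by `cos² + sin² = 1` and the subtraction formula; the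
differences are `2b, 2b, 4b`, and `cos` is even, so the sign `ε` drops out.
-/

noncomputable section

namespace Summit.CriticalPhenomena.SAWScalingLimit.Cruxes.SpinMonotone.AdjacentPort

/-- The three-phase identity at angles `b, 3b, 5b`:
`‖m₀ e^{ib} + m₁ e^{3ib} + m₂ e^{5ib}‖² = m₀² + m₁² + m₂² + 2(m₀m₁ + m₁m₂) cos 2b + 2 m₀m₂ cos 4b`.
[folklore] -/
private theorem normSq_threePhase (m₀ m₁ m₂ b : ℝ) :
    ‖(m₀ : ℂ) * Complex.exp ((b : ℂ) * Complex.I) +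
        (m₁ : ℂ) * Complex.exp (((3 * b : ℝ) : ℂ) * Complex.I) +
        (m₂ : ℂ) * Complex.exp (((5 * b : ℝ) : ℂ) * Complex.I)‖ ^ 2 =
      m₀ ^ 2 + m₁ ^ 2 + m₂ ^ 2 + 2 * (m₀ * m₁ + m₁ * m₂) * Real.cos (2 * b) +
        2 * (m₀ * m₂) * Real.cos (4 * b) := by
  have key : (m₀ : ℂ) * Complex.exp ((b : ℂ) * Complex.I) +
        (m₁ : ℂ) * Complex.exp (((3 * b : ℝ) : ℂ) * Complex.I) +
        (m₂ : ℂ) * Complex.exp (((5 * b : ℝ) : ℂ) * Complex.I) =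
      ((m₀ * Real.cos b + m₁ * Real.cos (3 * b) + m₂ * Real.cos (5 * b) : ℝ) : ℂ) +
        ((m₀ * Real.sin b + m₁ * Real.sin (3 * b) + m₂ * Real.sin (5 * b) : ℝ) : ℂ) *
          Complex.I := by
    simp only [Complex.exp_mul_I, ← Complex.ofReal_cos, ← Complex.ofReal_sin]
    push_cast
    ring
  rw [key, Complex.sq_norm, Complex.normSq_add_mul_I]
  have h1 : Real.cos b ^ 2 + Real.sin b ^ 2 = 1 := Real.cos_sq_add_sin_sq b
  have h3 : Real.cos (3 * b) ^ 2 + Real.sin (3 * b) ^ 2 = 1 := Real.cos_sq_add_sin_sq (3 * b)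
  have h5 : Real.cos (5 * b) ^ 2 + Real.sin (5 * b) ^ 2 = 1 := Real.cos_sq_add_sin_sq (5 * b)
  have h31 : Real.cos (2 * b) =
      Real.cos (3 * b) * Real.cos b + Real.sin (3 * b) * Real.sin b := by
    rw [← Real.cos_sub]; congr 1; ring
  have h53 : Real.cos (2 * b) =
      Real.cos (5 * b) * Real.cos (3 * b) + Real.sin (5 * b) * Real.sin (3 * b) := by
    rw [← Real.cos_sub]; congr 1; ring
  have h51 : Real.cos (4 * b) =
      Real.cos (5 * b) * Real.cos b + Real.sin (5 * b) * Real.sin b := by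
    rw [← Real.cos_sub]; congr 1; ring
  linear_combination m₀ ^ 2 * h1 + m₁ ^ 2 * h3 + m₂ ^ 2 * h5 - 2 * (m₀ * m₁) * h31 -
    2 * (m₁ * m₂) * h53 - 2 * (m₀ * m₂) * h51

/-- S1 (algebra): the squared modulus of the three-term sum is the quadratic form `Q(s)`.
For real masses `m₀ m₁ m₂`, a sign `ε = ±1` and a real spin `s`,
`‖m₀ e^{-isεπ/3} + m₁ e^{-isεπ} + m₂ e^{-5isεπ/3}‖² =
  m₀² + m₁² + m₂² + 2(m₀m₁ + m₁m₂) cos(2πs/3) + 2 m₀m₂ cos(4πs/3)` (the sign drops out because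
`cos` is even). [folklore] -/
theorem stub_normSq_threeTerm : ∀ (m₀ m₁ m₂ ε s : ℝ), (ε = 1 ∨ ε = -1) →
    ‖(m₀ : ℂ) * Complex.exp (-Complex.I * (s : ℂ) * ((ε * (Real.pi / 3) : ℝ) : ℂ)) +
        (m₁ : ℂ) * Complex.exp (-Complex.I * (s : ℂ) * ((ε * Real.pi : ℝ) : ℂ)) +
        (m₂ : ℂ) * Complex.exp (-Complex.I * (s : ℂ) * ((ε * (5 * Real.pi / 3) : ℝ) : ℂ))‖ ^ 2 =
      m₀ ^ 2 + m₁ ^ 2 + m₂ ^ 2 + 2 * (m₀ * m₁ + m₁ * m₂) * Real.cos (2 * Real.pi * s / 3) +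
        2 * (m₀ * m₂) * Real.cos (4 * Real.pi * s / 3) := by
  intro m₀ m₁ m₂ ε s hε
  obtain ⟨b, hb⟩ : ∃ b : ℝ, b = -(s * (ε * (Real.pi / 3))) := ⟨_, rfl⟩
  have e0 : -Complex.I * (s : ℂ) * ((ε * (Real.pi / 3) : ℝ) : ℂ) = (b : ℂ) * Complex.I := by
    rw [hb]; push_cast; ring
  have e1 : -Complex.I * (s : ℂ) * ((ε * Real.pi : ℝ) : ℂ) = ((3 * b : ℝ) : ℂ) * Complex.I := by
    rw [hb]; push_cast; ring
  have e2 : -Complex.I * (s : ℂ) * ((ε * (5 * Real.pi / 3) : ℝ) : ℂ) =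
      ((5 * b : ℝ) : ℂ) * Complex.I := by
    rw [hb]; push_cast; ring
  have c2 : Real.cos (2 * b) = Real.cos (2 * Real.pi * s / 3) := by
    rcases hε with rfl | rfl
    · rw [hb, ← Real.cos_neg]; congr 1; ring
    · rw [hb]; congr 1; ring
  have c4 : Real.cos (4 * b) = Real.cos (4 * Real.pi * s / 3) := by
    rcases hε with rfl | rfl
    · rw [hb, ← Real.cos_neg]; congr 1; ring
    · rw [hb]; congr 1; ring
  rw [e0, e1, e2, normSq_threePhase, c2, c4]

end Summit.CriticalPhenomena.SAWScalingLimit.Cruxes.SpinMonotone.AdjacentPort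

end
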